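import Mathlib
import HarnessLib
import Literature.Probability.Percolation.QuadCrossingSquareModel
import Literature.Barriers.CriticalPhenomena.EmbeddingModulusUniquenessProofs
import Literature.Probability.RandomPlanarGeometry.ConformalRectangleProofs
import Literature.Probability.RandomPlanarGeometry.ChordalCurveFamily
import Literature.Probability.RandomPlanarGeometry.DiamondShearChart
import Literature.Probability.RandomPlanarGeometry.ShearModulusAnalytic
import Summits.CriticalPhenomena.CardyFormulaZ2.Theorems.CardySelfDualSegmentSegmentOpenStubShearEnergyAnalytic
import Summits.CriticalPhenomena.CardyFormulaZ2.Theorems.CardySelfDualSegmentSegmentOpenStubShearCapacityEq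
import Summits.CriticalPhenomena.CardyFormulaZ2.Theorems.CardySelfDualSegmentSegmentOpenStubRectCapacity
import Summits.CriticalPhenomena.CardyFormulaZ2.Theorems.CardySelfDualSegmentSegmentOpenStubCapacityInvariant
import Summits.CriticalPhenomena.CardyFormulaZ2.Theorems.CardySelfDualSegmentSegmentOpenStubRectUniformization

/-!
# Crux `SegmentOpen` (stmt-CriticalPhenomena-5471), line `Sketch` — stub `stub_shearCrossRatioAnalytic` (S7)

S7 of line `Sketch` is, verbatim, the Literature named fact
`Literature.Probability.RandomPlanarGeometry.ShearCrossRatioAnalytic` (the conformal modulus of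
Beffara's sheared quad `φ_α R'` is a real-analytic function of the shear `α` on the upper
half-plane).  This file PROVES it — unconditionally, without quasiconformal theory — by the
DIRICHLET-PRINCIPLE ROUTE from the five landed stubs of the line:

* RU `stub_rectUniformization` (p129662): every conformal rectangle is conformally a model rectangle
  `rectQuad 0 w 0 h` with `λ(i h/w) = crossRatio`, with two-sided correspondence of arcs 0 and 2;
* DPinv `stub_capacity_invariant` (p128045): such an equivalence identifies the sets of admissible
  Dirichlet energies;
* DPrect `stub_rectCapacity` (p128591): the infimum of the admissible energies of `rectQuad 0 w 0 h`
  is `w / h`;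
* SH `stub_shearCapacity_eq` (p128176): the admissible energies of `φ_α R'` are the `α`-anisotropic
  energies of the admissible class of `R'`;
* AN `stub_shearEnergyAnalytic` (p130291): their infimum `E_{R'}(α)` is real-analytic on `{im α > 0}`.

Hence `crossRatio x = λ(1 / E_{R'}(α))` for every presentation of `φ_α R'`
(`crossRatio_shear_eq_lamR`), and `M := λ ∘ (·)⁻¹ ∘ E_{R'}` is real-analytic (`analyticAt_lamR`):
`stub_shearCrossRatioAnalytic`, and the Literature fact `shearCrossRatioAnalytic_holds`.
-/

noncomputable section

namespace Summit.CriticalPhenomena.CardyFormulaZ2.Theorems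

open Literature.Probability Literature.Barriers.CriticalPhenomena
open Literature.Probability.RandomPlanarGeometry (ConformalRectangle ConformalEquiv MarkedDomain)
open Filter Set Topology MeasureTheory
open UpperHalfPlane (upperHalfPlaneSet)

namespace ShearCrossRatioAnalyticProof

/-- RU + DPinv + DPrect: the infimum `Cap R` of the admissible Dirichlet energies of a conformal
rectangle is positive and the Cardy cross-ratio of every uniformizing datum is `λ(i / Cap R)`. -/
theorem crossRatio_eq_lamR_inv_cap (R : ConformalRectangle)
    (φ : ConformalEquiv upperHalfPlaneSet R.carrier) (x : Fin 4 → ℝ) (hφ : R.IsUniformizing φ x) :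
    0 < sInf {e : ℝ | ∃ U : ℂ → ℝ,
          (ContDiffOn ℝ 1 U R.carrier ∧
            IntegrableOn (fun z => ‖fderiv ℝ U z‖ ^ 2) R.carrier ∧
            (∃ O : Set ℂ, IsOpen O ∧ R.arc 0 ⊆ O ∧ ∀ z ∈ O ∩ R.carrier, U z = 0) ∧
            (∃ O : Set ℂ, IsOpen O ∧ R.arc 2 ⊆ O ∧ ∀ z ∈ O ∩ R.carrier, U z = 1)) ∧
          e = ∫ z in R.carrier, ‖fderiv ℝ U z‖ ^ 2} ∧
      RandomPlanarGeometry.crossRatio x = RandomPlanarGeometry.KlebanZagier.lamR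
        (sInf {e : ℝ | ∃ U : ℂ → ℝ,
          (ContDiffOn ℝ 1 U R.carrier ∧
            IntegrableOn (fun z => ‖fderiv ℝ U z‖ ^ 2) R.carrier ∧
            (∃ O : Set ℂ, IsOpen O ∧ R.arc 0 ⊆ O ∧ ∀ z ∈ O ∩ R.carrier, U z = 0) ∧
            (∃ O : Set ℂ, IsOpen O ∧ R.arc 2 ⊆ O ∧ ∀ z ∈ O ∩ R.carrier, U z = 1)) ∧
          e = ∫ z in R.carrier, ‖fderiv ℝ U z‖ ^ 2})⁻¹ := by
  obtain ⟨w, h, hw, hh, hlam, ψ, h0, h2, h0', h2'⟩ := stub_rectUniformization R φ x hφ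
  have hset := stub_capacity_invariant (Percolation.rectQuad 0 w 0 h hw hh) R ψ h0 h2 h0' h2'
  have hrect := stub_rectCapacity w h hw hh
  rw [hset] at hrect
  rw [hrect, inv_div, hlam]
  exact ⟨by positivity, rfl⟩

/-- Transport of the cross-ratio across two presentations with the same carrier and the same
marked points (`IsUniformizing` only sees `carrier` and `pt`). -/
theorem crossRatio_eq_of_carrier_eq {R D : ConformalRectangle} (hc : R.carrier = D.carrier)
    (hp : ∀ i, R.pt i = D.pt i)
    {φ : ConformalEquiv upperHalfPlaneSet R.carrier} {x : Fin 4 → ℝ} (h : R.IsUniformizing φ x)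
    {ψ : ConformalEquiv upperHalfPlaneSet D.carrier} {y : Fin 4 → ℝ} (h' : D.IsUniformizing ψ y) :
    RandomPlanarGeometry.crossRatio x = RandomPlanarGeometry.crossRatio y := by
  -- adapted from the crux disprover's `crossRatio_eq_of_carrier_eq` (Cruxes/SegmentOpen/Disproof.lean)
  have key : ∀ (S : Set ℂ) (hS : S = D.carrier) (φ' : ConformalEquiv upperHalfPlaneSet S),
      ((StrictMono x ∨ StrictAnti x) ∧ ∀ i, φ'.HasBoundaryValue (x i) (R.pt i)) →
        RandomPlanarGeometry.crossRatio x = RandomPlanarGeometry.crossRatio y := by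
    intro S hS φ' hφ'
    subst hS
    have hu : D.IsUniformizing φ' x := ⟨hφ'.1, fun i => by rw [← hp i]; exact hφ'.2 i⟩
    exact RandomPlanarGeometry.ConformalRectangle.crossRatio_eq_of_isUniformizing_holds hu h'
  exact key R.carrier hc φ h

/-- SH + the above, for the sheared quad: for `0 < im α` the shear energy `E_{R'}(α)` (infimum of
the `α`-anisotropic energies of the admissible class of `R'`) is positive, and every presentation
`(R, φ, x)` of `φ_α R'` has cross-ratio `λ(i / E_{R'}(α))`. -/
theorem crossRatio_shear_eq_lamR (R' : ConformalRectangle) {α : ℂ} (hα : 0 < α.im) :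
    0 < sInf {e : ℝ | ∃ U : ℂ → ℝ,
          (ContDiffOn ℝ 1 U R'.carrier ∧
            IntegrableOn (fun z => ‖fderiv ℝ U z‖ ^ 2) R'.carrier ∧
            (∃ O : Set ℂ, IsOpen O ∧ R'.arc 0 ⊆ O ∧ ∀ z ∈ O ∩ R'.carrier, U z = 0) ∧
            (∃ O : Set ℂ, IsOpen O ∧ R'.arc 2 ⊆ O ∧ ∀ z ∈ O ∩ R'.carrier, U z = 1)) ∧
          e = ∫ z in R'.carrier, (α.im * (fderiv ℝ U z 1) ^ 2 +
            (fderiv ℝ U z Complex.I - α.re * fderiv ℝ U z 1) ^ 2 / α.im)} ∧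
      ∀ (R : ConformalRectangle) (φ : ConformalEquiv upperHalfPlaneSet R.carrier) (x : Fin 4 → ℝ),
        R.carrier = moduliShear α '' R'.carrier → (∀ i, R.pt i = moduliShear α (R'.pt i)) →
        R.IsUniformizing φ x →
        RandomPlanarGeometry.crossRatio x = RandomPlanarGeometry.KlebanZagier.lamR
          (sInf {e : ℝ | ∃ U : ℂ → ℝ,
            (ContDiffOn ℝ 1 U R'.carrier ∧
              IntegrableOn (fun z => ‖fderiv ℝ U z‖ ^ 2) R'.carrier ∧
              (∃ O : Set ℂ, IsOpen O ∧ R'.arc 0 ⊆ O ∧ ∀ z ∈ O ∩ R'.carrier, U z = 0) ∧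
              (∃ O : Set ℂ, IsOpen O ∧ R'.arc 2 ⊆ O ∧ ∀ z ∈ O ∩ R'.carrier, U z = 1)) ∧
            e = ∫ z in R'.carrier, (α.im * (fderiv ℝ U z 1) ^ 2 +
              (fderiv ℝ U z Complex.I - α.re * fderiv ℝ U z 1) ^ 2 / α.im)})⁻¹ := by
  set Q : ConformalRectangle := R'.map (shearHomeomorph α hα.ne') with hQ
  obtain ⟨φQ, xQ, hQu⟩ := MarkedDomain.exists_isUniformizing_holds Q
  obtain ⟨hpos, hcr⟩ := crossRatio_eq_lamR_inv_cap Q φQ xQ hQu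
  rw [hQ, stub_shearCapacity_eq R' α hα] at hpos hcr
  refine ⟨hpos, fun R φ x hc hp hφ => ?_⟩
  rw [← hcr]
  refine crossRatio_eq_of_carrier_eq ?_ ?_ hφ hQu
  · rw [hc, hQ, MarkedDomain.carrier_map, coe_shearHomeomorph]
  · intro i
    rw [hp i, hQ, MarkedDomain.pt_map, coe_shearHomeomorph]

end ShearCrossRatioAnalyticProof

open ShearCrossRatioAnalyticProof in
/-- **S7 of line `Sketch`, PROVED (Dirichlet-principle route)**: for every conformal rectangle `R'`
there is `M : ℂ → ℝ`, real-analytic on `{α | 0 < im α}`, such that every uniformizing datum of every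
presentation of the sheared quad `φ_α R'` has Cardy cross-ratio `M α` — namely
`M α = λ(i / E_{R'}(α))`, `E_{R'}` the shear energy of AN. Composition of the five landed stubs
RU, DPinv, DPrect, SH, AN with `analyticAt_lamR`. -/
theorem stub_shearCrossRatioAnalytic :
    ∀ R' : ConformalRectangle, ∃ M : ℂ → ℝ, AnalyticOnNhd ℝ M {α : ℂ | 0 < α.im} ∧
      ∀ α : ℂ, 0 < α.im → ∀ (R : ConformalRectangle)
        (φ : ConformalEquiv UpperHalfPlane.upperHalfPlaneSet R.carrier) (x : Fin 4 → ℝ),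
        R.carrier = moduliShear α '' R'.carrier → (∀ i, R.pt i = moduliShear α (R'.pt i)) →
        R.IsUniformizing φ x → RandomPlanarGeometry.crossRatio x = M α := by
  intro R'
  set E : ℂ → ℝ := fun α => sInf {e : ℝ | ∃ U : ℂ → ℝ,
      (ContDiffOn ℝ 1 U R'.carrier ∧
        IntegrableOn (fun z => ‖fderiv ℝ U z‖ ^ 2) R'.carrier ∧
        (∃ O : Set ℂ, IsOpen O ∧ R'.arc 0 ⊆ O ∧ ∀ z ∈ O ∩ R'.carrier, U z = 0) ∧
        (∃ O : Set ℂ, IsOpen O ∧ R'.arc 2 ⊆ O ∧ ∀ z ∈ O ∩ R'.carrier, U z = 1)) ∧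
      e = ∫ z in R'.carrier, (α.im * (fderiv ℝ U z 1) ^ 2 +
        (fderiv ℝ U z Complex.I - α.re * fderiv ℝ U z 1) ^ 2 / α.im)} with hE
  refine ⟨fun α => RandomPlanarGeometry.KlebanZagier.lamR (E α)⁻¹, ?_, ?_⟩
  · intro α hα
    have hEa : AnalyticAt ℝ E α := stub_shearEnergyAnalytic R' α hα
    have hpos : 0 < E α := (crossRatio_shear_eq_lamR R' hα).1
    have hinv : AnalyticAt ℝ (fun β => (E β)⁻¹) α := hEa.inv hpos.ne'
    exact AnalyticAt.comp (g := RandomPlanarGeometry.KlebanZagier.lamR)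
      (f := fun β => (E β)⁻¹) (x := α)
      (RandomPlanarGeometry.analyticAt_lamR (inv_pos.2 hpos)) hinv
  · intro α hα R φ x hc hp hφ
    exact (crossRatio_shear_eq_lamR R' hα).2 R φ x hc hp hφ

/-- **The Literature named fact `ShearCrossRatioAnalytic` holds** (Ahlfors–Bers analyticity of
the modulus of Beffara's sheared quad, here by the Dirichlet principle — no quasiconformal
theory): it is `stub_shearCrossRatioAnalytic`, verbatim. -/
theorem shearCrossRatioAnalytic_holds :
    Literature.Probability.RandomPlanarGeometry.ShearCrossRatioAnalytic :=
  stub_shearCrossRatioAnalytic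

end Summit.CriticalPhenomena.CardyFormulaZ2.Theorems
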